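/-
Copyright (c) 2026. All rights reserved.
Released under Apache 2.0 license as described in the file LICENSE.
Authors: abc-iut cell, seat abc-iut-L4-t12 (discharge companion of abc-iut-L4-t9's block W2-B2).
-/
import Literature.AnabelianGeometry.AbsoluteAnabelian.AbsTopIII.BiAnabelianTelecoreFamily
import Literature.AnabelianGeometry.AbsoluteAnabelian.DiagramTelecores

/-!
# [AbsTopIII] Corollary 3.7 (ii), the telecore `𝔗_δ` and its contact structure — PROVED

S. Mochizuki, *Topics in absolute anabelian geometry III*, Cor 3.7 (ii) p. 87 (bib key
`MochizukiAbsTopIII2015`; locators = kurims manuscript pages, lit key `paper:url-5493eb38cbb7`):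
"`δ_𝒳` gives rise to a telecore structure `𝔗_δ` on `𝒟†_{≤1}` … by appending to `𝒟‡_{≤1}` telecore
edges … given by copies of `δ_𝒳`", and the `θ_⋎` "arising from `θ_𝒳`" give "[by restriction] a
contact structure on the telecore `𝔗_δ`".

Second proof companion of seat abc-iut-L4-t9's `BiAnabelianTelecore.lean`: from the universal
family `teleK θ` on `𝒟‡_δ` (`BiAnabelianTelecoreFamily.lean`) we assemble
* the telecore `teleT θ` of the PRINTED shape (`IsTelecoreDelta`: one edge `δ_⋎` per `⋎`, functor
  `δ_𝒳`) over t9's core of Cor 3.7 (i): its family `𝒥` is `teleK θ` restricted to the pairs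
  `([γ₃]∘[γ₁], [γ₃]∘[γ₂])` with `[γ₁], [γ₂]` ending at and `[γ₃]` starting from the core vertex
  (Def 3.5 (iv) (b); saturated because two such decompositions of one path are nested,
  `path_suffixes_nested`); `𝒥|_𝒮 = ℋ` holds because no included path contains a
  telecore edge (`eq_obs_of_mapPath_eq_comp`) and the core homotopies are the (unique) identities;
* the contact structure `teleK θ` itself (compatible with `𝒥` through `teleK θ`), containing the
  printed `θ_⋎` (`ContactPinned`, by uniqueness: `θ_𝒳` lies over the identity of `π_𝒳`, t9's
  `thetaX_hom_app_snd`);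
* `telecoreDeltaStmt_holds θ : 𝔖.TelecoreDeltaStmt θ` — Cor 3.7 (ii), telecore sentence, PROVED
  for every bi-anabelian setting with lift datum `θ^bi`; `cor_3_7_ii_iff_deltaFamily_and_starCore`:
  t9's `Cor_3_7_ii θ` reduces to `DeltaFamilyStmt θ ∧ StarGaloisCoreStmt`.
Refereed pre-IUT anabelian geometry; nothing here bears on [IUTchIII] Cor 3.12.
-/

set_option autoImplicit false

namespace Literature.AnabelianGeometry.AbsoluteAnabelian.AbsTopIII

open CategoryTheory Quiver DiagramOfCategories

universe u

/-- Two decompositions `p ∘ s = p' ∘ s'` of one path at a common intermediate vertex `o` are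
NESTED: one of `s`, `s'` is a suffix of the other through a loop at `o` (used for the transitivity
of the telecore boundary set of Def 3.5 (iv) (b)). [cite: MochizukiAbsTopIII2015, Definition 3.5 (iv) p.76] -/
theorem path_suffixes_nested {V : Type*} [Quiver V] {a o : V} :
    ∀ {b : V} (s s' : Quiver.Path o b) (p p' : Quiver.Path a o), p.comp s = p'.comp s' →
      (∃ t : Quiver.Path o o, s = t.comp s') ∨ (∃ t : Quiver.Path o o, s' = t.comp s) := by
  intro b s
  induction s with
  | nil => intro s' p p' _; exact Or.inr ⟨s', (Quiver.Path.comp_nil _).symm⟩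
  | cons s e ih =>
    intro s' p p' h
    cases s' with
    | nil => exact Or.inl ⟨s.cons e, (Quiver.Path.comp_nil _).symm⟩
    | cons s' e' =>
      have h' : (p.comp s).cons e = (p'.comp s').cons e' := h
      obtain rfl := Quiver.Path.obj_eq_of_cons_eq_cons h'
      obtain rfl := eq_of_heq (Quiver.Path.hom_heq_of_cons_eq_cons h')
      rcases ih s' p p' (eq_of_heq (Quiver.Path.heq_of_cons_eq_cons h')) with ⟨t, ht⟩ | ⟨t, ht⟩
      · exact Or.inl ⟨t, by rw [ht, Quiver.Path.comp_cons]⟩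
      · exact Or.inr ⟨t, by rw [ht, Quiver.Path.comp_cons]⟩

/-- `eqToHom`s between pairwise equal objects are heterogeneously equal (used to transport the
identity homotopies of the core along `𝒥|_𝒮 = ℋ`). [cite: MochizukiAbsTopIII2015, Definition 3.5 (iv) p.76] -/
private theorem eqToHom_heq_eqToHom {C : Type*} [Category C] {A B A' B' : C} (hA : A = A')
    (hB : B = B') (h : A = B) (h' : A' = B') : HEq (eqToHom h) (eqToHom h') := by
  subst hA; subst hB; rfl

namespace BiAnabelianSetting

variable {X E N : Type u} [Category.{u} X] [Category.{u} E] [Category.{u} N]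
  (𝔖 : BiAnabelianSetting X E N) (θ : FiberSquare.BiAnabelianLift 𝔖.gal)

/-! ## The telecore family `𝒥` of `𝔗_δ`: the universal homotopies on the core-suffix pairs -/

/-- The boundary set of `𝒥` (Def 3.5 (iv) (b)): pairs `([γ₃]∘[γ₁], [γ₃]∘[γ₂])` with `[γ₁], [γ₂]`
co-verticial paths ending at the core vertex and `[γ₃]` a path starting from it.
[cite: MochizukiAbsTopIII2015, Definition 3.5 (iv) p.76] -/
def TeleJE ⦃a b : 𝔖.teleShape.Vertex⦄ (p q : Path a b) : Prop :=
  ∃ (p₁ q₁ : Path a 𝔖.teleShape.obs) (r : Path 𝔖.teleShape.obs b), p = p₁.comp r ∧ q = q₁.comp r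

/-- The telecore boundary set is saturated (transitivity: two core-suffixes of a path are nested).
[cite: MochizukiAbsTopIII2015, Definition 3.5 (iv) p.76] -/
theorem isSaturated_teleJE : IsSaturated 𝔖.TeleJE where
  refl_left _ _ _ _ := fun ⟨p₁, _, r, hp, _⟩ => ⟨p₁, p₁, r, hp, hp⟩
  refl_right _ _ _ _ := fun ⟨_, q₁, r, _, hq⟩ => ⟨q₁, q₁, r, hq, hq⟩
  trans _ _ p q r := fun ⟨p₁, q₁, s, hp, hq⟩ ⟨p₂, q₂, s', hq', hr⟩ => by
    rcases path_suffixes_nested s s' q₁ p₂ (hq.symm.trans hq') with ⟨t, ht⟩ | ⟨t, ht⟩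
    · exact ⟨p₁.comp t, q₂, s', by rw [hp, ht, Path.comp_assoc], hr⟩
    · exact ⟨p₁, q₂.comp t, s, hp, by rw [hr, ht, Path.comp_assoc]⟩
  precomp _ _ _ _ _ := fun ⟨p₁, q₁, r, hp, hq⟩ s =>
    ⟨s.comp p₁, s.comp q₁, r, by rw [hp, Path.comp_assoc], by rw [hq, Path.comp_assoc]⟩
  postcomp _ _ _ _ _ := fun ⟨p₁, q₁, r, hp, hq⟩ s =>
    ⟨p₁, q₁, r.comp s, by rw [hp, Path.comp_assoc], by rw [hq, Path.comp_assoc]⟩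

/-- **The family `𝒥` of the telecore `𝔗_δ`**: the universal homotopies on the core-suffix pairs.
[cite: MochizukiAbsTopIII2015, Cor 3.7 (ii) p.87] -/
noncomputable def teleJfam : 𝔖.teleDiag.HomotopyFamily where
  E := 𝔖.TeleJE
  isSaturated := 𝔖.isSaturated_teleJE
  η := fun ⦃_ _⦄ ⦃p q⦄ _ => 𝔖.teleη θ p q
  η_refl _ _ p _ := 𝔖.teleη_refl θ p
  η_trans _ _ p q r _ _ := 𝔖.teleη_trans θ p q r
  η_whisker _ _ _ _ p q _ r₁ r₂ := 𝔖.teleη_whisker θ p q r₁ r₂ _ _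

/-! ## `𝒥|_𝒮 = ℋ`: included paths contain no telecore edge -/

/-- The graph inclusion `Γ⃗_{𝒟‡_{≤1}} ↪ Γ⃗_{𝒟‡_δ}` (t2's `telecoreInclusion` for our shape).
[cite: MochizukiAbsTopIII2015, Definition 3.5 (iv) p.76] -/
abbrev teleIncl : refCoreShape.{u}.Vertex ⥤q 𝔖.teleShape.Vertex :=
  telecoreInclusion 𝔖.refObs.shape 𝔖.refObs.isEmpty_J teleJ.{u}

/-- A path of `𝒟‡_{≤1}` whose image in `𝒟‡_δ` passes through the core vertex ENDS there: the image
contains no telecore edge, and no other edge leaves the core vertex.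
[cite: MochizukiAbsTopIII2015, Definition 3.5 (iv) p.76] -/
theorem eq_obs_of_mapPath_eq_comp {a : refCoreShape.{u}.Vertex} :
    ∀ {b : refCoreShape.{u}.Vertex} (p : Path a b) (p₁ : Path (𝔖.teleIncl.obj a) 𝔖.teleShape.obs)
      (r : Path 𝔖.teleShape.obs (𝔖.teleIncl.obj b)),
      𝔖.teleIncl.mapPath p = p₁.comp r → b = refCoreShape.{u}.obs := by
  intro b p
  induction p with
  | nil =>
    intro p₁ r h
    cases a with
    | obs => rfl
    | base w =>
      cases r with
      | cons r' e' => exact absurd h (Path.nil_ne_cons _ _)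
  | cons p e ih =>
    intro p₁ r h
    rename_i b' c
    cases c with
    | obs => rfl
    | base w =>
      cases r with
      | cons r' e' =>
        have h' : (𝔖.teleIncl.mapPath p).cons (𝔖.teleIncl.map e) = (p₁.comp r').cons e' := h
        have hc := Path.obj_eq_of_cons_eq_cons h'
        subst hc
        have hb' : b' = refCoreShape.{u}.obs :=
          ih p₁ r' (eq_of_heq (Path.heq_of_cons_eq_cons h'))
        subst hb'
        exact ((𝔖.refObs.isEmpty_J w).false e).elim

/-! ## The telecore `𝔗_δ` -/

/-- **The telecore `𝔗_δ`** on `𝒟†_{≤1}` over the core `(𝒟‡_{≤1}, 𝒳)` of Cor 3.7 (i): telecore edges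
`δ_⋎` carrying `δ_𝒳`, family `𝒥` = the universal homotopies on the core-suffix pairs, restricting
to the core's identity family. [cite: MochizukiAbsTopIII2015, Cor 3.7 (ii) p.87] -/
noncomputable def teleT : (𝔖.daggerLe 1).Telecore 𝔖.refObs 𝔖.refCoreObs_isCore where
  J := teleJ.{u}
  telMap j := 𝔖.teleMap j
  Jfam := 𝔖.teleJfam θ
  boundary_iff _ _ _ _ := Iff.rfl
  pathFunctor_incl _ _ p :=
    pathFunctor_telecoreInclusion (𝔖.daggerLe 1) 𝔖.refObs teleJ.{u} 𝔖.teleMap p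
  restrict_E := by
    intro a b p q
    constructor
    · intro h
      have hb : b = refCoreShape.{u}.obs := h
      subst hb
      exact ⟨𝔖.teleIncl.mapPath p, 𝔖.teleIncl.mapPath q, Path.nil, rfl, rfl⟩
    · rintro ⟨p₁, q₁, r, hp, _⟩
      exact 𝔖.eq_obs_of_mapPath_eq_comp p p₁ r hp
  restrict_η := by
    intro a b p q h
    have hb : b = refCoreShape.{u}.obs := h
    subst hb
    change HEq (eqToHom (𝔖.pathFunctor_eq_of_obs p q))
      (𝔖.teleη θ (𝔖.teleIncl.mapPath p) (𝔖.teleIncl.mapPath q))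
    cases a <;>
    · have hp := eq_of_heq
        (pathFunctor_telecoreInclusion (𝔖.daggerLe 1) 𝔖.refObs teleJ.{u} 𝔖.teleMap p)
      have hq := eq_of_heq
        (pathFunctor_telecoreInclusion (𝔖.daggerLe 1) 𝔖.refObs teleJ.{u} 𝔖.teleMap q)
      have key := 𝔖.teleη_eq θ (eqToHom (hp.symm.trans ((𝔖.pathFunctor_eq_of_obs p q).trans hq)))
        fun x => by rw [eqToHom_app, eqToHom_map]
      exact (eqToHom_heq_eqToHom hp hq (𝔖.pathFunctor_eq_of_obs p q)
        (hp.symm.trans ((𝔖.pathFunctor_eq_of_obs p q).trans hq))).trans (heq_of_eq key)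

/-! ## `𝔗_δ` has the printed shape; the contact structure; Cor 3.7 (ii) -/

/-- `𝔗_δ` has the PRINTED shape: one telecore edge `δ_⋎` to each `⋎`, carrying `δ_𝒳`.
[cite: MochizukiAbsTopIII2015, Cor 3.7 (ii) p.87] -/
theorem teleT_isTelecoreDelta : IsTelecoreDelta (𝔖.teleT θ) where
  nonempty_J _ := ⟨PUnit.unit⟩
  subsingleton_J a := by
    obtain ⟨a, ha⟩ := a
    cases a with
    | first n => exact ⟨fun _ _ => rfl⟩
    | box => exact ⟨fun j => (PEmpty.elim (j : PEmpty))⟩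
    | space => exact ⟨fun j => (PEmpty.elim (j : PEmpty))⟩
    | galois => exact ⟨fun j => (PEmpty.elim (j : PEmpty))⟩
    | ref => exact ⟨fun j => (PEmpty.elim (j : PEmpty))⟩
  telMap_eq _ _ := rfl

/-- The universal family is a **contact structure** for `𝔗_δ`: it is compatible with `𝒥` (both are
restrictions of the universal family). [cite: MochizukiAbsTopIII2015, Cor 3.7 (ii) p.87] -/
theorem teleK_isContactStructure :
    Telecore.IsContactStructure (𝔖.daggerLe 1) (𝔖.teleT θ) (𝔖.teleK θ) := by
  refine ⟨𝔖.teleK θ, fun i => ?_⟩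
  cases i
  · exact ⟨fun _ _ _ _ _ => trivial, fun _ _ _ _ _ => rfl⟩
  · exact ⟨fun _ _ _ _ h => h, fun _ _ _ _ _ => rfl⟩

/-- Shadow of a homotopy conjugated by `eqToHom`s of functor equalities (bookkeeping companion of
`ContactPinned`). [cite: MochizukiAbsTopIII2015, Definition 3.5 (ii) p.75] -/
private theorem map_conj_app {A S Y : Type u} [Category.{u} A] [Category.{u} S] [Category.{u} Y]
    {F P Q G : A ⥤ S} (t : S ⥤ Y) (hF : F = P) (hG : Q = G) (α : P ⟶ Q)
    (k : ∀ x, t.obj (P.obj x) = t.obj (Q.obj x)) (hα : ∀ x, t.map (α.app x) = eqToHom (k x))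
    (x : A) (h : t.obj (F.obj x) = t.obj (G.obj x)) :
    t.map ((eqToHom hF ≫ α ≫ eqToHom hG).app x) = eqToHom h := by
  subst hF hG
  simp only [eqToHom_refl, Category.id_comp, Category.comp_id]
  exact hα x

/-- The universal family CONTAINS the printed contact homotopies: its homotopy for the pair
`([γ¹_⋎], [γ⁰_⋎])` is `θ_⋎`, "the isomorphism arising from `θ_𝒳`" (by uniqueness: `θ_𝒳` lies over
the identity of `π_𝒳`). [cite: MochizukiAbsTopIII2015, Cor 3.7 (ii) p.88] -/
theorem teleK_contactPinned : ContactPinned θ (𝔖.teleT θ) (𝔖.teleK θ) := by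
  intro n j
  refine ⟨trivial, fun o e₁ e₂ => ?_⟩
  have E₁ : 𝔖.teleDiag.pathFunctor (teleGammaOne (𝔖.teleT θ) n j) = 𝔖.proj ⋙ 𝔖.diag := by
    erw [pathFunctor_cons, pathFunctor_cons, pathFunctor_nil]
    rfl
  have E₂ : 𝟭 𝔖.Sq = 𝔖.teleDiag.pathFunctor (Path.nil : Path (tv (𝔖.teleT θ) n) _) :=
    (pathFunctor_nil 𝔖.teleDiag (tv (𝔖.teleT θ) n)).symm
  have key := (𝔖.teleη_eq θ (eqToHom E₁ ≫ θ.thetaX.hom ≫ eqToHom E₂) fun x =>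
    map_conj_app 𝔖.proj E₁ E₂ θ.thetaX.hom (fun _ => rfl)
      (fun y => by
        change (θ.thetaX.hom.app y).snd = _
        rw [FiberSquare.BiAnabelianLift.thetaX_hom_app_snd]
        exact (eqToHom_refl _ _).symm) x _).symm
  have h2 : (eqToHom E₁ ≫ θ.thetaX.hom ≫ eqToHom E₂).app o =
      eqToHom (Functor.congr_obj E₁ o) ≫ θ.thetaX.hom.app o ≫ eqToHom (Functor.congr_obj E₂ o) := by
    rw [NatTrans.comp_app, NatTrans.comp_app, eqToHom_app, eqToHom_app]
  exact (congrArg (fun t => NatTrans.app t o) key).trans h2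

/-- **Cor 3.7 (ii), the telecore `𝔗_δ` with its contact structure, PROVED** for every bi-anabelian
setting with lift datum `θ^bi`: over the natural core structure of Cor 3.7 (i) on `(𝒟‡_{≤1}, 𝒳)`
there is a telecore of the printed shape (edges `δ_⋎`, functor `δ_𝒳`) with a contact structure
containing the `θ_⋎`. [cite: MochizukiAbsTopIII2015, Cor 3.7 (ii) p.87] -/
theorem telecoreDeltaStmt_holds : 𝔖.TelecoreDeltaStmt θ :=
  ⟨𝔖.refCoreFamily, 𝔖.refCoreFamily_terminal, 𝔖.refCoreObs_isCore, 𝔖.teleT θ,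
    𝔖.teleT_isTelecoreDelta θ, 𝔖.teleK θ, 𝔖.teleK_isContactStructure θ, 𝔖.teleK_contactPinned θ⟩

/-- Hence t9's `Cor_3_7_ii θ` reduces to the family `ℋ_δ` on `𝒟*` and the core `𝒟*` on `𝒟*_{≤3}`
(the latter is seat abc-iut-L4-t9's `starGaloisCoreStmt_holds`, separate file).
[cite: MochizukiAbsTopIII2015, Cor 3.7 (ii) pp.87–88] -/
theorem cor_3_7_ii_iff_deltaFamily_and_starCore :
    𝔖.Cor_3_7_ii θ ↔ 𝔖.DeltaFamilyStmt θ ∧ 𝔖.StarGaloisCoreStmt :=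
  ⟨fun h => h.2, fun h => ⟨𝔖.telecoreDeltaStmt_holds θ, h⟩⟩

end BiAnabelianSetting

end Literature.AnabelianGeometry.AbsoluteAnabelian.AbsTopIII
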